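import Summits.ResolutionOfSingularities.ResolutionOfSingularities.Theorems.FrobeniusLadderFInjectiveMacaulayficationX2YGBlowupRegular
import HarnessLib

/-!
# The rank-one double-point family `x′² + y·g = 0` with `V(g)` SMOOTH (pointwise derivations): blowing up `(x′, y, g)` IS REGULAR and `Sing = V(x′, y, g)`, every characteristic
# (the POINTWISE twin of ✓p674996 `X2YGBlowupRegular`, whose hypothesis was ONE global derivation `D₀` with `D₀ g` a unit modulo `g` (Euler on Fermat-type `g`); here only
# «at every prime `Q ∋ g` of `Λ` some derivation `D` has `D g ∉ Q`» — i.e. `Λ/(g)` smooth in the sense of Stacks 07PF — so that NON-diagonal smooth `g` (general smooth cubic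
# forms, the habitat of a class-level T″ row) are covered; crux `FInjectiveMacaulayfication` stmt-ResolutionOfSingularities-15315, chain w45a; seat res-L1-w45a-lead-1 g11)

[OURS · L1 W4.5a] Support file (`--supports stmt-ResolutionOfSingularities-15315 --as helper`); replaces the role of NO printed item; NOT a statement of any
manuscript; def-free; UNCONDITIONAL; commutative algebra + one scheme sentence. AI-written (AI review is weaker than expert review).

SETTING (generic, as in `X2YGCentre`). `Λ` a REGULAR ring with a family of derivations (over any base `S₀`) separating the primes of `V(g)`: `∀ Q ∋ g` prime `∃ D, D g ∉ Q`;
`Λ/(g)` a domain (so a regular domain, Stacks 07PF `isRegularRing_quotient_of_derivations`); `R = Λ[T₀, T₁]`, `cen = (T₀, T₁, C g)`, `I = (cen)`, `h = T₀² + T₁·C g`,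
`C = R/(h)`, `J = I·C`. Every statement of `X2YGBlowupRegular` is re-proved under this weaker hypothesis (the global form follows by taking the constant family `D₀`).
NO HYPOTHESIS ON THE CHARACTERISTIC: the derivative `∂_{T₀} h = 2T₀` is never used — at a prime containing `T₁` and `g` the equation itself puts `T₀² ∈ 𝔓`.
* §1 reuses `X2YGBlowupRegular.pderiv_one_h` (`∂_{T₁} h = C g`), `coeffwiseDerivation_h` (`D̃ h = T₁ · C(D g)`).
* §2 `hoff_one` — `R[1/T₁]/(h)` is regular: at `Q ∋ h`, if `C g ∉ Q` use `∂_{T₁}`, else pick `D` for the prime `Q ∩ Λ ∋ g`: `D̃ h = T₁·C(D g) ∉ Q`; `hoff_two` — `R[1/g]/(h)`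
  is regular (`∂_{T₁} h = C g` a unit).
* §3 `isRegularRing_chart` — the two graph-type chart rings `R[I/T₁]/(g/T₁ + (T₀/T₁)²)`, `R[I/g]/(T₁/g + (T₀/g)²)` are regular
  (`StrictTransformGraphType.isRegularRing_quotient_odp` at `(p,p′,q,q′) = (1,2,0,0), (2,1,0,0)`).
* §4 `isRegularRing_blowupAlgebra_map_of_chart` (GW 13.96 (2): `C[J/c̄_p]` IS `R[I/cen p]/(h′_p)`), ★★ `isRegularRing_blowupAlgebra_strictTransform` — `C[J/ȳ]` and
  `C[J/ḡ]` are regular rings; ★ generic `isRegular_affineBlowup_of_sq_eq_neg_mul` — for ANY ring `A` and `c : Fin 3 → A` with `c₀² = −c₁c₂`, `Bl_{(c)} Spec A` is a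
  regular scheme as soon as the two chart rings `A[(c)/c₁]`, `A[(c)/c₂]` are (`(c₁, c₂)` is a reduction, `X2YGCentre.sq_le_span_mul_of_sq_eq` +
  `affineBlowup.isRegular_of_isRegularRing_blowupAlgebra_of_pow_le`); ★★ `isRegular_affineBlowup_strictTransform` — **`Bl_J Spec C` IS A REGULAR SCHEME**.
* §5 `map_le_of_not_isRegularLocalRing` — a prime `P` of `C` with `C_P` not regular contains `J` (Stacks 07PF with `∂_{T₁}`, the pointwise `D̃`, and `T₀² = h − T₁·C g`);
  `not_isRegularLocalRing_iff_map_le` — **`Sing(Spec C) = V(J)`**; `isPrime_map_span_cen` — `J` is prime (`C/J ≅ Λ/(g)`).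
`pointwise_of_isUnit`: the global hypothesis of `X2YGBlowupRegular` implies the pointwise one. [folklore; cite: Liu2002, Thm. 8.1.19 (a)] [cite: StacksProject, Tag 07PF; Tag 0BIQ]
[cite: GortzWedhorn2020, Prop. 13.96 (2), Prop. 13.91 (4), (13.19)]
-/

-- single-problem summit: the doubled namespace component is forced
set_option linter.dupNamespace false

noncomputable section

namespace Summit.ResolutionOfSingularities.ResolutionOfSingularities.Theorems.FInjectiveMacaulayfication.X2YGBlowupRegularLocal

open MvPolynomial Literature.AlgebraicGeometry.Resolution AlgebraicGeometry
open Summit.ResolutionOfSingularities.ResolutionOfSingularities.Theorems.FInjectiveMacaulayfication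
open Summit.ResolutionOfSingularities.ResolutionOfSingularities.Cruxes.EquisingularLiftNat.Sections (prime_algebraMap_of_isQuasiRegular)
open Summit.ResolutionOfSingularities.ResolutionOfSingularities.Theorems.EquisingularLift.SpecimenQuartic (isRegularRing_quotient_of_derivations)

universe u v

variable {Λ : Type u} [CommRing Λ] (g : Λ) (cen : Fin 3 → MvPolynomial (Fin 2) Λ) (h : MvPolynomial (Fin 2) Λ)

/-! ## §1 (The derivative identities `X2YGBlowupRegular.pderiv_one_h` / `coeffwiseDerivation_h` are reused.) -/

/-! ## §2 The hypersurface `h` is regular off `V(T₁)` and off `V(C g)` -/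

/-- ★ **`hoff` on the chart `T₁ = y`** (pointwise form): `R[1/T₁]/(h)` is a regular ring. At a prime `Q ∋ h` of `L = R[1/T₁]`: if `C g ∉ Q` the value `∂_{T₁} h = C g` works;
if `C g ∈ Q` pick a derivation `D` of `Λ` with `D g ∉ Q ∩ Λ` (a prime of `Λ` containing `g`): the coefficientwise extension has value `T₁·C(D g) ∉ Q` (`T₁` a unit).
NO use of `∂_{T₀}` — characteristic-free. [folklore; cite: StacksProject, Tag 07PF] -/
theorem hoff_one [IsRegularRing Λ] {S₀ : Type v} [CommRing S₀] [Algebra S₀ Λ]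
    (hD : ∀ Q : Ideal Λ, Q.IsPrime → g ∈ Q → ∃ D : Derivation S₀ Λ Λ, D g ∉ Q) (hcen : cen = ![X 0, X 1, C g]) (hh : h = X 0 ^ 2 + X 1 * C g) :
    IsRegularRing (Localization.Away (cen 1) ⧸ Ideal.span {algebraMap (MvPolynomial (Fin 2) Λ) (Localization.Away (cen 1)) (cen 1 * cen 2 + cen 0 * cen 0)}) := by
  obtain ⟨-, h1, -⟩ := X2YGCentre.cen_apply g cen hcen
  rw [← (X2YGCentre.h_eq_odp g cen h hcen hh).1]
  refine ODPCurveBlowupRegular.isRegularRing_localization_quotient_of_derivations (S₀ := S₀) (Submonoid.powers (cen 1)) h fun Q hQ _ => ?_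
  by_cases hgQ : algebraMap (MvPolynomial (Fin 2) Λ) (Localization.Away (cen 1)) (C g) ∈ Q
  · -- the prime `Q ∩ Λ` of `Λ` contains `g`: pick a derivation there
    haveI : (Q.comap ((algebraMap (MvPolynomial (Fin 2) Λ) (Localization.Away (cen 1))).comp C)).IsPrime := Ideal.comap_isPrime _ Q
    obtain ⟨D, hDg⟩ := hD (Q.comap ((algebraMap (MvPolynomial (Fin 2) Λ) (Localization.Away (cen 1))).comp C)) inferInstance
      (by rw [Ideal.mem_comap, RingHom.comp_apply]; exact hgQ)
    refine ⟨coeffwiseDerivation (ι := Fin 2) D, ?_⟩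
    rw [X2YGBlowupRegular.coeffwiseDerivation_h g h D hh, map_mul]
    intro hmem
    have hu : IsUnit (algebraMap (MvPolynomial (Fin 2) Λ) (Localization.Away (cen 1)) (X 1)) := by
      rw [← h1]; exact IsLocalization.Away.algebraMap_isUnit (cen 1)
    have hDg' : algebraMap (MvPolynomial (Fin 2) Λ) (Localization.Away (cen 1)) (C (D g)) ∈ Q :=
      (hQ.mem_or_mem hmem).resolve_left (ODPCurveBlowupRegular.not_mem_of_isUnit hQ hu)
    exact hDg (by rw [Ideal.mem_comap, RingHom.comp_apply]; exact hDg')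
  · exact ⟨(pderiv 1 : Derivation Λ (MvPolynomial (Fin 2) Λ) (MvPolynomial (Fin 2) Λ)).restrictScalars S₀,
      by rw [Derivation.restrictScalars_apply, X2YGBlowupRegular.pderiv_one_h g h hh]; exact hgQ⟩

/-! ## §3 The two chart instances of `StrictTransformGraphType.isRegularRing_quotient_odp` -/

/-- ★ **The two chart rings `R[I/T₁]/(h′₁)`, `R[I/g]/(h′₂)` are regular rings** (`h′₁ = g/T₁ + (T₀/T₁)²`, `h′₂ = T₁/g + (T₀/g)²`, the graph-type strict transforms of `h`;
`Λ` regular, pointwise derivations on `V(g)`, `Λ/(g)` a domain). [folklore; cite: Liu2002, Thm. 8.1.19 (a); StacksProject, Tag 0BIQ] -/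
theorem isRegularRing_chart [IsRegularRing Λ] [IsDomain (Λ ⧸ Ideal.span {g})] (hg : IsSMulRegular Λ g) {S₀ : Type v} [CommRing S₀] [Algebra S₀ Λ]
    (hD : ∀ Q : Ideal Λ, Q.IsPrime → g ∈ Q → ∃ D : Derivation S₀ Λ Λ, D g ∉ Q) (hcen : cen = ![X 0, X 1, C g])
    (hh : h = X 0 ^ 2 + X 1 * C g) :
    IsRegularRing (blowupAlgebra (Ideal.span (Set.range cen)) (cen 1) ⧸
        Ideal.span {blowupAlgebra.frac cen 1 2 + blowupAlgebra.frac cen 1 0 * blowupAlgebra.frac cen 1 0}) ∧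
      IsRegularRing (blowupAlgebra (Ideal.span (Set.range cen)) (cen 2) ⧸
        Ideal.span {blowupAlgebra.frac cen 2 1 + blowupAlgebra.frac cen 2 0 * blowupAlgebra.frac cen 2 0}) := by
  haveI : IsRegularRing (Λ ⧸ Ideal.span {g}) := isRegularRing_quotient_of_derivations (S₀ := S₀) g hD
  haveI := X2YGCentre.isDomain_quotient g cen hcen
  haveI := X2YGCentre.isRegularRing_quotient g cen hcen
  have hx := X2YGCentre.isQuasiRegular_cen g cen hcen hg
  refine ⟨?_, ?_⟩
  · exact StrictTransformGraphType.isRegularRing_quotient_odp cen hx 1 2 0 0 (by decide) (by decide) (by decide) (by decide) (by decide)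
      (hoff_one g cen h hD hcen hh)
  · exact StrictTransformGraphType.isRegularRing_quotient_odp cen hx 2 1 0 0 (by decide) (by decide) (by decide) (by decide) (by decide)
      (X2YGBlowupRegular.hoff_two g cen h hcen hh)

/-! ## §4 The strict transform: the two chart rings of `Bl_J Spec C` are regular; `Bl_J Spec C` is a regular scheme -/

/-- ★★ **THE CHART RINGS `C[J/ȳ]` AND `C[J/ḡ]` OF THE BLOWING UP OF `C = R/(h)` ALONG `J = (x′, y, g)·C` ARE REGULAR RINGS** (`Λ` regular, `Λ/(g)` a domain, `g` a
non-zero-divisor, pointwise derivations on `V(g)`; ANY characteristic). [folklore; cite: Liu2002, Thm. 8.1.19 (a)] [cite: GortzWedhorn2020, Prop. 13.96 (2)] -/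
theorem isRegularRing_blowupAlgebra_strictTransform [IsRegularRing Λ] [IsDomain (Λ ⧸ Ideal.span {g})] (hg : IsSMulRegular Λ g)
    {S₀ : Type v} [CommRing S₀] [Algebra S₀ Λ] (hD : ∀ Q : Ideal Λ, Q.IsPrime → g ∈ Q → ∃ D : Derivation S₀ Λ Λ, D g ∉ Q)
    (hcen : cen = ![X 0, X 1, C g]) (hh : h = X 0 ^ 2 + X 1 * C g)
    (J : Ideal (MvPolynomial (Fin 2) Λ ⧸ Ideal.span {h})) (hJ : J = (Ideal.span (Set.range cen)).map (Ideal.Quotient.mk (Ideal.span {h}))) :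
    IsRegularRing (blowupAlgebra J (Ideal.Quotient.mk (Ideal.span {h}) (cen 1))) ∧
      IsRegularRing (blowupAlgebra J (Ideal.Quotient.mk (Ideal.span {h}) (cen 2))) := by
  obtain ⟨r1, r2⟩ := isRegularRing_chart g cen h hg hD hcen hh
  obtain ⟨e1, e2⟩ := X2YGCentre.h_eq_odp g cen h hcen hh
  exact ⟨X2YGBlowupRegular.isRegularRing_blowupAlgebra_map_of_chart g cen h hg hcen J hJ 1 2 0 0 (by decide) (by decide) (by decide) (by decide) (by decide) e1 r1,
    X2YGBlowupRegular.isRegularRing_blowupAlgebra_map_of_chart g cen h hg hcen J hJ 2 1 0 0 (by decide) (by decide) (by decide) (by decide) (by decide) e2 r2⟩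

/-- ★★ **THE BLOWING UP `Bl_J Spec C` IS A REGULAR SCHEME** (`C = Λ[x′, y]/(x′² + y·g)`, `J = (x′, y, g)·C`; hypotheses as above, ANY characteristic).
[folklore; cite: Liu2002, Thm. 8.1.19 (a)] [cite: GortzWedhorn2020, Prop. 13.91 (4), (13.19)] -/
theorem isRegular_affineBlowup_strictTransform [IsRegularRing Λ] [IsDomain (Λ ⧸ Ideal.span {g})] (hg : IsSMulRegular Λ g)
    {S₀ : Type v} [CommRing S₀] [Algebra S₀ Λ] (hD : ∀ Q : Ideal Λ, Q.IsPrime → g ∈ Q → ∃ D : Derivation S₀ Λ Λ, D g ∉ Q)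
    (hcen : cen = ![X 0, X 1, C g]) (hh : h = X 0 ^ 2 + X 1 * C g)
    (J : Ideal (MvPolynomial (Fin 2) Λ ⧸ Ideal.span {h})) (hJ : J = (Ideal.span (Set.range cen)).map (Ideal.Quotient.mk (Ideal.span {h}))) :
    Scheme.IsRegular (affineBlowup J) := by
  obtain ⟨r1, r2⟩ := isRegularRing_blowupAlgebra_strictTransform g cen h hg hD hcen hh J hJ
  exact X2YGBlowupRegular.isRegular_affineBlowup_of_sq_eq_neg_mul J (fun l => Ideal.Quotient.mk (Ideal.span {h}) (cen l))
    (hJ.trans (X2YGCentre.map_span_range_cen_eq cen h)) (X2YGCentre.mk_cen_zero_sq g cen h hcen hh) r1 r2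

/-! ## §5 The singular locus of `C` is exactly `V(J)` -/

/-- ★ **A singular point of `C = R/(h)` contains `J`** (pointwise form): if `C_P` is not regular then, for `𝔓 = P ∩ R`: `C g = ∂_{T₁}h ∈ 𝔓`; picking `D` with `D g ∉ 𝔓 ∩ Λ`,
`T₁·C(D g) = D̃ h ∈ 𝔓` (Stacks 07PF, `Derivation.apply_mem_comap_of_not_isRegularLocalRing`) forces `T₁ ∈ 𝔓`, and finally `T₀ ∈ 𝔓` because
`T₀² = h − T₁·C g ∈ 𝔓`. Characteristic-free. [cite: StacksProject, Tag 07PF] -/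
theorem map_le_of_not_isRegularLocalRing [IsRegularRing Λ] {S₀ : Type v} [CommRing S₀] [Algebra S₀ Λ]
    (hD : ∀ Q : Ideal Λ, Q.IsPrime → g ∈ Q → ∃ D : Derivation S₀ Λ Λ, D g ∉ Q) (hcen : cen = ![X 0, X 1, C g]) (hh : h = X 0 ^ 2 + X 1 * C g)
    (P : Ideal (MvPolynomial (Fin 2) Λ ⧸ Ideal.span {h})) [P.IsPrime] (hP : ¬ IsRegularLocalRing (Localization.AtPrime P)) :
    (Ideal.span (Set.range cen)).map (Ideal.Quotient.mk (Ideal.span {h})) ≤ P := by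
  obtain ⟨h0, h1, h2⟩ := X2YGCentre.cen_apply g cen hcen
  haveI hp : (P.comap (Ideal.Quotient.mk (Ideal.span {h}))).IsPrime := Ideal.comap_isPrime _ P
  have hCg : (C g : MvPolynomial (Fin 2) Λ) ∈ P.comap (Ideal.Quotient.mk (Ideal.span {h})) := by
    have := Derivation.apply_mem_comap_of_not_isRegularLocalRing (pderiv 1 : Derivation Λ (MvPolynomial (Fin 2) Λ) (MvPolynomial (Fin 2) Λ)) h P hP
    rwa [X2YGBlowupRegular.pderiv_one_h g h hh] at this
  -- the prime `𝔮 = P ∩ Λ` contains `g`: pick a derivation `D` with `D g ∉ 𝔮`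
  haveI : ((P.comap (Ideal.Quotient.mk (Ideal.span {h}))).comap (C : Λ →+* MvPolynomial (Fin 2) Λ)).IsPrime := Ideal.comap_isPrime _ _
  obtain ⟨D, hDg⟩ := hD ((P.comap (Ideal.Quotient.mk (Ideal.span {h}))).comap (C : Λ →+* MvPolynomial (Fin 2) Λ)) inferInstance
    (by rw [Ideal.mem_comap]; exact hCg)
  have hX1 : (X 1 : MvPolynomial (Fin 2) Λ) ∈ P.comap (Ideal.Quotient.mk (Ideal.span {h})) := by
    have hw := Derivation.apply_mem_comap_of_not_isRegularLocalRing (coeffwiseDerivation (ι := Fin 2) D) h P hP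
    rw [X2YGBlowupRegular.coeffwiseDerivation_h g h D hh] at hw
    rcases hp.mem_or_mem hw with hw1 | hDg'
    · exact hw1
    · exact absurd (by rw [Ideal.mem_comap]; exact hDg') hDg
  have hhP : h ∈ P.comap (Ideal.Quotient.mk (Ideal.span {h})) := by
    rw [Ideal.mem_comap, Ideal.Quotient.eq_zero_iff_mem.mpr (Ideal.mem_span_singleton_self h)]
    exact P.zero_mem
  have hX0 : (X 0 : MvPolynomial (Fin 2) Λ) ∈ P.comap (Ideal.Quotient.mk (Ideal.span {h})) := by
    apply hp.mem_of_pow_mem 2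
    have e : (X 0 ^ 2 : MvPolynomial (Fin 2) Λ) = h - X 1 * C g := by rw [hh]; ring
    rw [e]
    exact Ideal.sub_mem _ hhP (Ideal.mul_mem_right _ _ hX1)
  rw [Ideal.map_le_iff_le_comap, Ideal.span_le]
  rintro _ ⟨j, rfl⟩
  fin_cases j
  · exact h0 ▸ hX0
  · exact h1 ▸ hX1
  · exact h2 ▸ hCg

/-- ★ **`Sing(Spec C) = V(J)`**: for `Λ` a regular domain, `g ≠ 0`, pointwise derivations on `V(g)`: a prime `P` of `C = R/(h)` is a SINGULAR point iff `P ⊇ J`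
(`X2YGCentre.not_isRegularLocalRing_of_le` + `map_le_of_not_isRegularLocalRing`), pointwise-derivation form. ANY characteristic. [cite: StacksProject, Tag 07PF] [cite: Matsumura1987, Thm. 14.2] -/
theorem not_isRegularLocalRing_iff_map_le [IsRegularRing Λ] [IsDomain Λ] (hg0 : g ≠ 0) {S₀ : Type v} [CommRing S₀] [Algebra S₀ Λ]
    (hD : ∀ Q : Ideal Λ, Q.IsPrime → g ∈ Q → ∃ D : Derivation S₀ Λ Λ, D g ∉ Q) (hcen : cen = ![X 0, X 1, C g])
    (hh : h = X 0 ^ 2 + X 1 * C g) (P : Ideal (MvPolynomial (Fin 2) Λ ⧸ Ideal.span {h})) [P.IsPrime] :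
    ¬ IsRegularLocalRing (Localization.AtPrime P) ↔ (Ideal.span (Set.range cen)).map (Ideal.Quotient.mk (Ideal.span {h})) ≤ P :=
  ⟨map_le_of_not_isRegularLocalRing g cen h hD hcen hh P, X2YGCentre.not_isRegularLocalRing_of_le g cen h hg0 hcen hh P⟩

/-- **From the global form**: one derivation `D₀` with `D₀ g` a unit modulo `g` gives the pointwise family (the constant one). [plumbing] -/
theorem pointwise_of_isUnit {S₀ : Type v} [CommRing S₀] [Algebra S₀ Λ] (D₀ : Derivation S₀ Λ Λ) (hD₀ : IsUnit (Ideal.Quotient.mk (Ideal.span {g}) (D₀ g))) :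
    ∀ Q : Ideal Λ, Q.IsPrime → g ∈ Q → ∃ D : Derivation S₀ Λ Λ, D g ∉ Q := by
  intro Q hQ hgQ
  obtain ⟨s, t, hst⟩ := ODPCurveBlowupRegular.exists_mul_eq_one_add g D₀ hD₀
  refine ⟨D₀, fun hDg => hQ.ne_top ((Ideal.eq_top_iff_one _).mpr ?_)⟩
  have e : (1 : Λ) = D₀ g * s - g * t := by rw [hst]; ring
  rw [e]
  exact Q.sub_mem (Q.mul_mem_right _ hDg) (Q.mul_mem_right _ hgQ)

end Summit.ResolutionOfSingularities.ResolutionOfSingularities.Theorems.FInjectiveMacaulayfication.X2YGBlowupRegularLocal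

end
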